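import Summits.Ventures.YMGap.RobustBall.TruncatedSummableBall
import Summits.Ventures.YMGap.Thresholds.TruncatedTools
import HarnessLib

/-!
# Venture YMGap, track ROBUST-BALL (Y2) — «C-SMOOTH-BALL» (iv), DOOR-AGNOSTIC CORE: A FAMILY OF STATES WITH COVARIANCE DECAY AND THE FIRST-ORDER
# FEYNMAN–HELLMANN FORMULA ALONG A DIRECTION IS `C^∞` ALONG IT — ALL ORDERS AT ONCE

HONEST FRAMING. WHAT THIS IS: a venture file (cell `pub-ymgap`, track Y2 ROBUST-BALL, seat rb-p1, theorems only), the endpoint of the regularity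
ladder stated ONCE for every door.  Input: a family of probability measures `ν(s)`, `|s| ≤ s₀`, on `SU(N)` lattice gauge configurations with
(a) the COVARIANCE-DECAY PROPERTY uniformly on the segment (`|cov_{ν(s)}(f, g)| ≤ C_cov (Σδ_g)(Σδ_f) e^{−t d(Δ_f, Δ_g)}` for bounded measurable local
observables with Frobenius-Lipschitz vectors), (b) the FIRST-ORDER FEYNMAN–HELLMANN FORMULA along the direction `V` for every such observable `g`
(`d/ds ∫ g dν(s) = −Σ'_X cov_{ν(s)}(g, V_X)` on `|s| < s₀`) and (c) summability of these susceptibility series; direction terms `V_X` measurable bounded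
local with Frobenius-Lipschitz witnesses `lipV_X` of finite EXPONENTIALLY DIAMETER-WEIGHTED LOAD `Σ'_{X ∋ e} e^{t·dia X} Σ_y lipV_X y ≤ L_d`; `F`
bounded measurable local (`Λ_F ≠ ∅`) Frobenius-Lipschitz; `V^c_X := V_X − V_X(1)`, `u_{n+1} = Cumulants.trunc`.  (The pair door supplies (a)(b)(c) by
`abs_cov_le_of_isLipBound_S`, `StateDerivativeOnBallS`, `DirectionalSusceptibilityS` — file `StateSmoothS`; the star door by their star twins —
file `StateSmoothStar`.)
* ★★ `hasDerivAt_trunc_of_response` — Feynman–Hellmann for the truncated functions of every order: at every `|s| < s₀`,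
  `d/ds u_{n+1}(F; V^c_{q 0}; …; V^c_{q(n−1)})_{ν(s)} = −Σ'_X u_{n+2}(F; V^c_{q 0}; …; V^c_{q(n−1)}; V^c_X)_{ν(s)}` ((b) on the product slots, chain rule
  `hasDerivAt_ac`, `dac_tsum`, and ds-1's fresh-slot identity `dac_eq_ac_insert`);
* ★★★ `hasDerivAt_truncSum_of_response` — the order-`n` response series is differentiable with derivative minus the order-`(n+1)` series
  (termwise differentiation under the fibre domination `tsum_abs_trunc_snoc_le_of_covDecay`, uniform on the segment by (a));
* ★★★ `iteratedDeriv_integral_of_response` — `(d/ds)ⁿ ∫ F dν(s) = (−1)ⁿ Σ'_{q : Fin n → Finset (links)} u_{n+1}(F; V^c_{q 0}; …; V^c_{q(n−1)})_{ν(s)}`;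
* ★★★ `contDiffOn_infty_integral_of_response` — `s ↦ ∫ F dν(s)` IS `ContDiffOn ℝ ∞` ON `(−s₀, s₀)` (no nonemptiness assumption on `Λ_F`).
WHAT THIS IS NOT: analyticity (the constants grow super-factorially in the order); nothing about the continuum limit or a Clay-sense mass gap.
-/

noncomputable section

open MeasureTheory Function Finset ProbabilityTheory Real Filter Topology
open scoped NNReal ContDiff
open Literature.Probability.LatticeModels
open Literature.Probability.LatticeModels.DobrushinMetric
open Literature.MathematicalPhysics.QuantumLattice
open Literature.MathematicalPhysics.QuantumFieldTheory hiding ZdEdge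
open Summit.Ventures.YMGap.Cumulants
open Summit.Ventures.YMGap.CouplingResponse (covariance_eq_sub_of_abs_le tsum_snoc_eq)

namespace Summit.Ventures.YMGap.RobustBall

variable {d N : ℕ}

/-- Local shorthand: the outer radius `R(X) = max_{y ∈ X} dist(y, Λ)` of a link set about `Λ` (`0` for `X = ∅`). -/
local notation3 (prettyPrint := false) "Rad[" Λ "," X "]" =>
  ((Finset.sup X fun y => (linkSetDist Λ y).toNNReal : ℝ≥0) : ℝ)

/-- The plain Lipschitz load is dominated by the exponentially diameter-weighted one (`dia ≥ 0`). -/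
theorem plainLoad_of_expLoad {t : ℝ} {lipV : Finset (ZdEdge d) → ZdEdge d → ℝ} (hlip0 : ∀ X y, 0 ≤ lipV X y)
    {dia : Finset (ZdEdge d) → ℝ} (hdia0 : ∀ X, 0 ≤ t * dia X) {Ld : ℝ}
    (hLs : ∀ e, Summable fun X : Finset (ZdEdge d) => (if e ∈ X then exp (t * dia X) * ∑ y ∈ X, lipV X y else 0))
    (hL : ∀ e, ∑' X : Finset (ZdEdge d), (if e ∈ X then exp (t * dia X) * ∑ y ∈ X, lipV X y else 0) ≤ Ld) (e : ZdEdge d) :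
    Summable (fun X : Finset (ZdEdge d) => (if e ∈ X then ∑ y ∈ X, lipV X y else 0)) ∧
      ∑' X : Finset (ZdEdge d), (if e ∈ X then ∑ y ∈ X, lipV X y else 0) ≤ Ld := by
  have hle : ∀ X : Finset (ZdEdge d), (if e ∈ X then ∑ y ∈ X, lipV X y else 0) ≤
      (if e ∈ X then exp (t * dia X) * ∑ y ∈ X, lipV X y else 0) := fun X => by
    split_ifs
    · exact le_mul_of_one_le_left (sum_nonneg fun y _ => hlip0 X y) (one_le_exp (hdia0 X))
    · exact le_rfl
  have h0 : ∀ X : Finset (ZdEdge d), 0 ≤ (if e ∈ X then ∑ y ∈ X, lipV X y else 0) := fun X => by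
    split_ifs; exacts [sum_nonneg fun y _ => hlip0 X y, le_rfl]
  have hs := (hLs e).of_nonneg_of_le h0 hle
  exact ⟨hs, (hs.tsum_le_tsum hle (hLs e)).trans (hL e)⟩

section SUN

variable {V : Finset (ZdEdge d) → LGConfig d (Matrix.specialUnitaryGroup (Fin N) ℂ) → ℝ}

set_option maxHeartbeats 800000 in
/-- ★★ **FEYNMAN–HELLMANN FOR THE TRUNCATED FUNCTIONS OF EVERY ORDER.**  A family of probability measures `ν(s)` on `|s| ≤ s₀` with the first-order
Feynman–Hellmann formula along `V` for every bounded measurable local Frobenius-Lipschitz observable and summable susceptibility series; direction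
terms measurable, bounded, local, with Frobenius-Lipschitz witnesses.  Then for every `n`, every `q : Fin n → Finset (links)` and every `|s| < s₀`:
`HasDerivAt (s ↦ u_{n+1}(F; V^c_{q 0}; …; V^c_{q(n−1)})_{ν(s)}) (−Σ'_X u_{n+2}(F; V^c_{q 0}; …; V^c_{q(n−1)}; V^c_X)_{ν(s)}) s`. -/
theorem hasDerivAt_trunc_of_response {s₀ : ℝ}
    {ν : ℝ → Measure (LGConfig d (Matrix.specialUnitaryGroup (Fin N) ℂ))} (hprob : ∀ s ∈ Set.Icc (-s₀) s₀, IsProbabilityMeasure (ν s))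
    (hVm : ∀ X, Measurable (V X)) (hVdep : ∀ X, DependsOn (V X) (↑X : Set (ZdEdge d))) (hVb : ∀ X, ∃ C, ∀ U, |V X U| ≤ C)
    {lipV : Finset (ZdEdge d) → ZdEdge d → ℝ} (hlipV : ∀ X, IsLipBound suFrobDist (V X) (lipV X))
    (hC1 : ∀ (g : LGConfig d (Matrix.specialUnitaryGroup (Fin N) ℂ) → ℝ) (Δ : Finset (ZdEdge d)) (M : ℝ) (δ : ZdEdge d → ℝ),
      Measurable g → DependsOn g (↑Δ : Set (ZdEdge d)) → (∀ σ, |g σ| ≤ M) → IsLipBound suFrobDist g δ →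
      ∀ s ∈ Set.Ioo (-s₀) s₀, HasDerivAt (fun s => ∫ σ, g σ ∂(ν s)) (-(∑' X : Finset (ZdEdge d), cov[g, V X; ν s])) s)
    (hSum : ∀ s ∈ Set.Icc (-s₀) s₀, ∀ (g : LGConfig d (Matrix.specialUnitaryGroup (Fin N) ℂ) → ℝ) (Δ : Finset (ZdEdge d)) (M : ℝ)
      (δ : ZdEdge d → ℝ), Measurable g → DependsOn g (↑Δ : Set (ZdEdge d)) → (∀ σ, |g σ| ≤ M) → IsLipBound suFrobDist g δ →
      Summable fun X : Finset (ZdEdge d) => cov[g, V X; ν s])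
    {F : LGConfig d (Matrix.specialUnitaryGroup (Fin N) ℂ) → ℝ} (hFm : Measurable F) {ΛF : Finset (ZdEdge d)}
    (hFdep : DependsOn F (↑ΛF : Set (ZdEdge d))) {MF : ℝ} (hMF : ∀ σ, |F σ| ≤ MF) {δF : ZdEdge d → ℝ}
    (hδF : IsLipBound suFrobDist F δF) (n : ℕ) (q : Fin n → Finset (ZdEdge d)) :
    ∀ s ∈ Set.Ioo (-s₀) s₀, HasDerivAt (fun s => trunc (ν s) F (fun X σ => V X σ - V X 1) q)
      (-(∑' X : Finset (ZdEdge d), trunc (ν s) F (fun X σ => V X σ - V X 1) (Fin.snoc q X : Fin (n + 1) → Finset (ZdEdge d)))) s := by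
  classical
  intro s₁ hs₁
  have hs₁' : s₁ ∈ Set.Icc (-s₀) s₀ := Set.Ioo_subset_Icc_self hs₁
  haveI : IsProbabilityMeasure (ν s₁) := hprob s₁ hs₁'
  -- the centred direction and the slot family
  set Vc : Finset (ZdEdge d) → LGConfig d (Matrix.specialUnitaryGroup (Fin N) ℂ) → ℝ := fun X σ => V X σ - V X 1 with hVc
  have hVcm : ∀ X, Measurable (Vc X) := fun X => (hVm X).sub measurable_const
  have hVcdep : ∀ X, DependsOn (Vc X) (↑X : Set (ZdEdge d)) := fun X => (centred_data (hVdep X) (hlipV X)).1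
  have hVclip : ∀ X, IsLipBound suFrobDist (Vc X) (lipV X) := fun X => (centred_data (hVdep X) (hlipV X)).2.1
  set SV : Finset (ZdEdge d) → ℝ := fun X => ∑ y ∈ X, lipV X y with hSV
  have hVcb : ∀ X σ, |Vc X σ| ≤ 2 * Real.sqrt N * SV X := fun X => (centred_data (hVdep X) (hlipV X)).2.2
  set Δs : ℕ → Finset (ZdEdge d) := fun i => Nat.casesOn i ΛF fun j => if h : j < n then q ⟨j, h⟩ else ∅ with hΔs
  set Ms : ℕ → ℝ := fun i => Nat.casesOn i MF fun j => if h : j < n then 2 * Real.sqrt N * SV (q ⟨j, h⟩) else 1 with hMs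
  set δs : ℕ → ZdEdge d → ℝ := fun i => Nat.casesOn i δF fun j => if h : j < n then lipV (q ⟨j, h⟩) else fun _ => 0 with hδs
  set X := slots F Vc q with hX
  have hXdep : ∀ i, DependsOn (X i) (↑(Δs i) : Set (ZdEdge d)) := slots_dependsOn q hFdep hVcdep (Δs := Δs) rfl fun _ => rfl
  have hXM : ∀ i σ, |X i σ| ≤ Ms i := slots_abs_le (MV := fun X => 2 * Real.sqrt N * SV X) q hMF hVcb (Ms := Ms) rfl fun _ => rfl
  have hXδ : ∀ i, IsLipBound suFrobDist (X i) (δs i) := slots_isLipBound q hδF hVclip (δs := δs) rfl fun _ => rfl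
  have hXm : ∀ i, Measurable (X i) := slots_measurable q hFm hVcm
  set S : Finset ℕ := Finset.range (n + 1) with hS
  -- the product slots: data
  have hPm : ∀ T : Finset ℕ, Measurable fun σ => ∏ i ∈ T, X i σ := fun T => Finset.measurable_prod _ fun i _ => hXm i
  have hPdep : ∀ T : Finset ℕ, DependsOn (fun σ => ∏ i ∈ T, X i σ) (↑(T.biUnion Δs) : Set (ZdEdge d)) := fun T =>
    dependsOn_prod_slots fun i _ => hXdep i
  have hPM : ∀ T : Finset ℕ, ∀ σ, |∏ i ∈ T, X i σ| ≤ ∏ i ∈ T, Ms i := fun T => abs_prod_slots_le fun i _ => hXM i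
  have hPlip : ∀ T : Finset ℕ, ∃ δT : ZdEdge d → ℝ, IsLipBound suFrobDist (fun σ => ∏ i ∈ T, X i σ) δT := fun T => by
    obtain ⟨δT, hδT, -⟩ := exists_isLipBound_prod_slots (fun _ _ => suFrobDist_nonneg _ _) (1 : LGConfig d _) (T := T)
      (fun i _ => hXdep i) (fun i _ => hXM i) fun i _ => hXδ i
    exact ⟨δT, hδT⟩
  -- the moments are `C¹` along the line, derivative = minus the susceptibility series of the product slot
  set m : ℝ → Finset ℕ → ℝ := fun s T => mom (ν s) X T with hm
  set m'r : Finset (ZdEdge d) → Finset ℕ → ℝ := fun A T => -cov[fun σ => ∏ i ∈ T, X i σ, V A; ν s₁] with hm'r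
  set m' : Finset ℕ → ℝ := fun T => ∑' A, m'r A T with hm'
  have hmom : ∀ T ⊆ S, HasDerivAt (fun s => m s T) (m' T) s₁ := by
    intro T _
    obtain ⟨δT, hδT⟩ := hPlip T
    have h := hC1 _ _ _ δT (hPm T) (hPdep T) (hPM T) hδT s₁ hs₁
    have e : m' T = -(∑' A : Finset (ZdEdge d), cov[fun σ => ∏ i ∈ T, X i σ, V A; ν s₁]) := by
      simp only [hm', hm'r, tsum_neg]
    rw [e]
    exact h
  have hder := hasDerivAt_ac hmom 0 S subset_rfl
  refine hder.congr_deriv ?_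
  -- summability of the susceptibility series of each product slot, and `dac` through the sum
  have hs : ∀ T ⊆ S, Summable fun A => m'r A T := by
    intro T _
    obtain ⟨δT, hδT⟩ := hPlip T
    exact (hSum s₁ hs₁' _ _ _ δT (hPm T) (hPdep T) (hPM T) hδT).neg
  obtain ⟨-, hsum⟩ := dac_tsum (m := m s₁) hs 0 S subset_rfl
  rw [← hsum]
  rw [← tsum_neg]
  refine tsum_congr fun A => ?_
  -- the fresh-slot identity for the term `V^c_A` in slot `n + 1`
  obtain ⟨CA, hCA⟩ := hVb A
  set M : Finset ℕ → ℝ := mom (ν s₁) (slots F Vc (Fin.snoc q A : Fin (n + 1) → Finset (ZdEdge d))) with hM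
  have hsS : n + 1 ∉ S := by simp [hS]
  have hagree : ∀ i ∈ S, slots F Vc (Fin.snoc q A : Fin (n + 1) → Finset (ZdEdge d)) i = X i := fun i hi =>
    slots_snoc_of_le F _ q A (Nat.lt_succ_iff.1 (Finset.mem_range.1 hi))
  have hMm : ∀ T ⊆ S, M T = m s₁ T := mom_congr (ν s₁) hagree
  have hlast := slots_snoc_last F Vc q A
  have hneg : ∀ T, dac (m s₁) (m'r A) 0 T = -dac (m s₁) (fun T => cov[fun σ => ∏ i ∈ T, X i σ, V A; ν s₁]) 0 T := fun T => by
    have h := dac_const_mul (m := m s₁) (m' := fun T => cov[fun σ => ∏ i ∈ T, X i σ, V A; ν s₁]) (-1) 0 T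
    simp only [neg_mul, one_mul] at h
    exact h
  have hm'M : ∀ T ⊆ S, cov[fun σ => ∏ i ∈ T, X i σ, V A; ν s₁] = M (insert (n + 1) T) - m s₁ T * M {n + 1} := by
    intro T hTS
    have hsT : n + 1 ∉ T := fun h => hsS (hTS h)
    have hVint : Integrable (V A) (ν s₁) := (integrable_const CA).mono' (hVm A).aestronglyMeasurable
      (Eventually.of_forall fun σ => by rw [Real.norm_eq_abs]; exact hCA σ)
    have e0 : cov[fun σ => ∏ i ∈ T, X i σ, V A; ν s₁] = cov[fun σ => ∏ i ∈ T, X i σ, Vc A; ν s₁] := by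
      simp only [hVc]
      rw [covariance_sub_const_right hVint]
    have e1 : M (insert (n + 1) T) = ∫ U, (∏ i ∈ T, X i U) * Vc A U ∂(ν s₁) := by
      simp only [hM, mom]
      refine integral_congr_ae (ae_of_all _ fun U => ?_)
      dsimp only
      rw [Finset.prod_insert hsT, hlast, mul_comm]
      congr 1
      exact Finset.prod_congr rfl fun i hi => by rw [hagree i (hTS hi)]
    have e2 : M {n + 1} = ∫ U, Vc A U ∂(ν s₁) := by
      simp only [hM, mom, Finset.prod_singleton]
      refine integral_congr_ae (ae_of_all _ fun U => ?_)
      rw [hlast]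
    rw [e0, e1, e2]
    exact covariance_eq_sub_of_abs_le (hPm T) (hVcm A) (hPM T) (hVcb A)
  have key := dac_eq_ac_insert (a := 0) hsS hMm hm'M S subset_rfl (Finset.mem_range.2 (Nat.succ_pos n))
  rw [hneg, key]
  show -ac M 0 (insert (n + 1) (Finset.range (n + 1))) = -ac M 0 (Finset.range (n + 1 + 1))
  rw [← Finset.range_add_one]

/-- ★★★ **THE ORDER-`n` RESPONSE SERIES ALONG A LINE OF THE BALL IS DIFFERENTIABLE, WITH DERIVATIVE MINUS THE ORDER-`(n+1)` SERIES.**  Under the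
hypotheses of `hasDerivAt_trunc_of_response`, for every `n` and every `|s| < s₀`:
`HasDerivAt (s ↦ Σ'_{q : Fin n → Finset} u_{n+1}(F; V^c_q …)_{ν(s)}) (−Σ'_{q' : Fin (n+1) → Finset} u_{n+2}(F; V^c_{q'} …)_{ν(s)}) s`. -/
theorem hasDerivAt_truncSum_of_response (hd : 1 ≤ d) {s₀ Ccov t : ℝ} (hCcov : 0 ≤ Ccov) (ht : 0 < t)
    {ν : ℝ → Measure (LGConfig d (Matrix.specialUnitaryGroup (Fin N) ℂ))} (hprob : ∀ s ∈ Set.Icc (-s₀) s₀, IsProbabilityMeasure (ν s))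
    (hCov : ∀ s ∈ Set.Icc (-s₀) s₀,
      ∀ (f g : LGConfig d (Matrix.specialUnitaryGroup (Fin N) ℂ) → ℝ) (Δf Δg : Finset (ZdEdge d)) (Mf Mg : ℝ) (δf δg : ZdEdge d → ℝ),
      Measurable f → DependsOn f (↑Δf : Set (ZdEdge d)) → (∀ σ, |f σ| ≤ Mf) → IsLipBound suFrobDist f δf →
      Measurable g → DependsOn g (↑Δg : Set (ZdEdge d)) → (∀ σ, |g σ| ≤ Mg) → IsLipBound suFrobDist g δg →
        |cov[f, g; ν s]| ≤ Ccov * (∑ y ∈ Δg, δg y) * (∑ y ∈ Δf, δf y) * exp (-(t * setDistEdges Δf Δg)))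
    (hVm : ∀ X, Measurable (V X)) (hVdep : ∀ X, DependsOn (V X) (↑X : Set (ZdEdge d))) (hVb : ∀ X, ∃ C, ∀ U, |V X U| ≤ C)
    {lipV : Finset (ZdEdge d) → ZdEdge d → ℝ} (hlipV : ∀ X, IsLipBound suFrobDist (V X) (lipV X))
    (hC1 : ∀ (g : LGConfig d (Matrix.specialUnitaryGroup (Fin N) ℂ) → ℝ) (Δ : Finset (ZdEdge d)) (M : ℝ) (δ : ZdEdge d → ℝ),
      Measurable g → DependsOn g (↑Δ : Set (ZdEdge d)) → (∀ σ, |g σ| ≤ M) → IsLipBound suFrobDist g δ →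
      ∀ s ∈ Set.Ioo (-s₀) s₀, HasDerivAt (fun s => ∫ σ, g σ ∂(ν s)) (-(∑' X : Finset (ZdEdge d), cov[g, V X; ν s])) s)
    (hSum : ∀ s ∈ Set.Icc (-s₀) s₀, ∀ (g : LGConfig d (Matrix.specialUnitaryGroup (Fin N) ℂ) → ℝ) (Δ : Finset (ZdEdge d)) (M : ℝ)
      (δ : ZdEdge d → ℝ), Measurable g → DependsOn g (↑Δ : Set (ZdEdge d)) → (∀ σ, |g σ| ≤ M) → IsLipBound suFrobDist g δ →
      Summable fun X : Finset (ZdEdge d) => cov[g, V X; ν s])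
    {dia : Finset (ZdEdge d) → ℝ} (hdia0 : ∀ X, 0 ≤ dia X) (hdia : ∀ X, ∀ y ∈ X, ∀ z ∈ X, ‖y.1 - z.1‖ ≤ dia X) {Ld : ℝ} (hLd0 : 0 ≤ Ld)
    (hLs : ∀ e, Summable fun X : Finset (ZdEdge d) => (if e ∈ X then exp (t * dia X) * ∑ y ∈ X, lipV X y else 0))
    (hL : ∀ e, ∑' X : Finset (ZdEdge d), (if e ∈ X then exp (t * dia X) * ∑ y ∈ X, lipV X y else 0) ≤ Ld)
    {F : LGConfig d (Matrix.specialUnitaryGroup (Fin N) ℂ) → ℝ} (hFm : Measurable F) {ΛF : Finset (ZdEdge d)} (hΛF : ΛF.Nonempty)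
    (hFdep : DependsOn F (↑ΛF : Set (ZdEdge d))) {MF : ℝ} (hMF : ∀ σ, |F σ| ≤ MF) {δF : ZdEdge d → ℝ}
    (hδF : IsLipBound suFrobDist F δF) (n : ℕ) :
    ∀ s ∈ Set.Ioo (-s₀) s₀, HasDerivAt (fun s => ∑' q : Fin n → Finset (ZdEdge d), trunc (ν s) F (fun X σ => V X σ - V X 1) q)
      (-(∑' q' : Fin (n + 1) → Finset (ZdEdge d), trunc (ν s) F (fun X σ => V X σ - V X 1) q')) s := by
  classical
  intro s₁ hs₁
  set I : Set ℝ := Set.Ioo (-s₀) s₀ with hI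
  have hII : I ⊆ Set.Icc (-s₀) s₀ := Set.Ioo_subset_Icc_self
  set Vc : Finset (ZdEdge d) → LGConfig d (Matrix.specialUnitaryGroup (Fin N) ℂ) → ℝ := fun X σ => V X σ - V X 1 with hVc
  -- the fibre domination at order `n + 1`, uniform on the segment
  set A : ℝ := cumBound (n + 2) * (1 + Ccov) * (MF + ∑ y ∈ ΛF, δF y) with hA
  set Z : ℝ := (2 * Real.sqrt N + 1) * Ld *
    (ΛF.card * (d * ((1 + exp (-(t / ↑(n + 1) ^ 2 / d))) / (1 - exp (-(t / ↑(n + 1) ^ 2 / d)))) ^ d)) with hZ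
  set Φ : Finset (ZdEdge d) → ℝ := fun X => (2 * Real.sqrt N + 1) * (∑ y ∈ X, lipV X y) * exp (t / ↑(n + 1) * dia X) *
    exp (-(t / ↑(n + 1) ^ 2 * Rad[ΛF, X])) with hΦ
  have hMF0 : 0 ≤ MF := (abs_nonneg _).trans (hMF 1)
  have hSF0 : 0 ≤ ∑ y ∈ ΛF, δF y := sum_nonneg fun y _ => hδF.nonneg y
  have hN1 : (0 : ℝ) ≤ 2 * Real.sqrt N + 1 := by positivity
  have hA0 : 0 ≤ A := mul_nonneg (mul_nonneg (cumBound_pos (n + 2)).le (by linarith)) (add_nonneg hMF0 hSF0)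
  have hZ0 : 0 ≤ Z := by
    have hr1 : exp (-(t / ↑(n + 1) ^ 2 / d)) < 1 := exp_lt_one_iff.2 (by
      have : (0 : ℝ) < d := by exact_mod_cast hd
      have : 0 < t / ↑(n + 1) ^ 2 / d := by positivity
      linarith)
    have : 0 < 1 - exp (-(t / ↑(n + 1) ^ 2 / d)) := by linarith
    positivity
  have hΦ0 : ∀ X, 0 ≤ Φ X := fun X => by
    have := sum_nonneg fun y (_ : y ∈ X) => (hlipV X).nonneg y
    positivity
  set u : (Fin n → Finset (ZdEdge d)) → ℝ := fun q => A * Z * ∏ i, Φ (q i) with hu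
  have hu0 : ∀ q, 0 ≤ u q := fun q => mul_nonneg (mul_nonneg hA0 hZ0) (prod_nonneg fun i _ => hΦ0 _)
  have hus : Summable u :=
    (summable_pi_of_abs_le_prod (f := u) (mul_nonneg hA0 hZ0) hΦ0
      (sum_weight_le (N := N) hd ht hΛF (fun X y => (hlipV X).nonneg y) hdia0 hLd0 hLs hL (Nat.succ_pos n))
      (fun q => by rw [abs_of_nonneg (hu0 q)])).1
  have h := hasDerivAt_tsum_of_isPreconnected hus isOpen_Ioo (convex_Ioo (-s₀) s₀).isPreconnected
    (g := fun q s => trunc (ν s) F Vc q)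
    (g' := fun q s => -(∑' X : Finset (ZdEdge d), trunc (ν s) F Vc (Fin.snoc q X : Fin (n + 1) → Finset (ZdEdge d))))
    (fun q s hs => hasDerivAt_trunc_of_response hprob hVm hVdep hVb hlipV hC1 hSum hFm hFdep hMF hδF n q s hs)
    (fun q s hs => ?_) hs₁
    (by
      haveI := hprob s₁ (hII hs₁)
      exact (summable_trunc_of_covDecay hd hCcov ht (hCov s₁ (hII hs₁)) hFm hΛF hFdep hMF hδF hVm hVdep hlipV hdia0 hdia hLd0 hLs hL n).1) hs₁
  · refine h.congr_deriv ?_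
    rw [tsum_neg]
    congr 1
    haveI := hprob s₁ (hII hs₁)
    exact (tsum_snoc_eq (summable_trunc_of_covDecay hd hCcov ht (hCov s₁ (hII hs₁)) hFm hΛF hFdep hMF hδF hVm hVdep hlipV hdia0 hdia hLd0
      hLs hL (n + 1)).1).symm
  · haveI := hprob s (hII hs)
    obtain ⟨hfs, hle⟩ := tsum_abs_trunc_snoc_le_of_covDecay hd hCcov ht (hCov s (hII hs)) hFm hΛF hFdep hMF hδF hVm hVdep hlipV hdia0 hdia
      hLd0 hLs hL n q
    rw [norm_neg]
    refine (norm_tsum_le_tsum_norm hfs.norm).trans ?_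
    simpa only [Real.norm_eq_abs, hu, hA, hZ, hΦ] using hle

/-- **Order zero of the response series is the mean**: `Σ'_{q : Fin 0 → P} u_1(F)_μ = ∫ F dμ`. -/
theorem tsum_trunc_fin_zero_S {P : Type*} (μ : Measure (LGConfig d (Matrix.specialUnitaryGroup (Fin N) ℂ)))
    (F : LGConfig d (Matrix.specialUnitaryGroup (Fin N) ℂ) → ℝ) (U : P → LGConfig d (Matrix.specialUnitaryGroup (Fin N) ℂ) → ℝ) :
    ∑' q : Fin 0 → P, trunc μ F U q = ∫ σ, F σ ∂μ := by
  rw [tsum_fintype, Fintype.sum_unique]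
  exact trunc_fin_zero μ F U _

/-- ★★★ **THE `n`-TH DERIVATIVE OF THE STATE ALONG THE LINE IS `(−1)ⁿ` TIMES THE ORDER-`n` RESPONSE SERIES.**  Under the hypotheses of
`hasDerivAt_trunc_of_response` (`Λ_F ≠ ∅`), for every `n` and every `|s| < s₀`:
`iteratedDeriv n (s ↦ ∫ F dν(s)) s = (−1)ⁿ Σ'_{q : Fin n → Finset (links)} u_{n+1}(F; V^c_{q 0}; …; V^c_{q(n−1)})_{ν(s)}`. -/
theorem iteratedDeriv_integral_of_response (hd : 1 ≤ d) {s₀ Ccov t : ℝ} (hCcov : 0 ≤ Ccov) (ht : 0 < t)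
    {ν : ℝ → Measure (LGConfig d (Matrix.specialUnitaryGroup (Fin N) ℂ))} (hprob : ∀ s ∈ Set.Icc (-s₀) s₀, IsProbabilityMeasure (ν s))
    (hCov : ∀ s ∈ Set.Icc (-s₀) s₀,
      ∀ (f g : LGConfig d (Matrix.specialUnitaryGroup (Fin N) ℂ) → ℝ) (Δf Δg : Finset (ZdEdge d)) (Mf Mg : ℝ) (δf δg : ZdEdge d → ℝ),
      Measurable f → DependsOn f (↑Δf : Set (ZdEdge d)) → (∀ σ, |f σ| ≤ Mf) → IsLipBound suFrobDist f δf →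
      Measurable g → DependsOn g (↑Δg : Set (ZdEdge d)) → (∀ σ, |g σ| ≤ Mg) → IsLipBound suFrobDist g δg →
        |cov[f, g; ν s]| ≤ Ccov * (∑ y ∈ Δg, δg y) * (∑ y ∈ Δf, δf y) * exp (-(t * setDistEdges Δf Δg)))
    (hVm : ∀ X, Measurable (V X)) (hVdep : ∀ X, DependsOn (V X) (↑X : Set (ZdEdge d))) (hVb : ∀ X, ∃ C, ∀ U, |V X U| ≤ C)
    {lipV : Finset (ZdEdge d) → ZdEdge d → ℝ} (hlipV : ∀ X, IsLipBound suFrobDist (V X) (lipV X))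
    (hC1 : ∀ (g : LGConfig d (Matrix.specialUnitaryGroup (Fin N) ℂ) → ℝ) (Δ : Finset (ZdEdge d)) (M : ℝ) (δ : ZdEdge d → ℝ),
      Measurable g → DependsOn g (↑Δ : Set (ZdEdge d)) → (∀ σ, |g σ| ≤ M) → IsLipBound suFrobDist g δ →
      ∀ s ∈ Set.Ioo (-s₀) s₀, HasDerivAt (fun s => ∫ σ, g σ ∂(ν s)) (-(∑' X : Finset (ZdEdge d), cov[g, V X; ν s])) s)
    (hSum : ∀ s ∈ Set.Icc (-s₀) s₀, ∀ (g : LGConfig d (Matrix.specialUnitaryGroup (Fin N) ℂ) → ℝ) (Δ : Finset (ZdEdge d)) (M : ℝ)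
      (δ : ZdEdge d → ℝ), Measurable g → DependsOn g (↑Δ : Set (ZdEdge d)) → (∀ σ, |g σ| ≤ M) → IsLipBound suFrobDist g δ →
      Summable fun X : Finset (ZdEdge d) => cov[g, V X; ν s])
    {dia : Finset (ZdEdge d) → ℝ} (hdia0 : ∀ X, 0 ≤ dia X) (hdia : ∀ X, ∀ y ∈ X, ∀ z ∈ X, ‖y.1 - z.1‖ ≤ dia X) {Ld : ℝ} (hLd0 : 0 ≤ Ld)
    (hLs : ∀ e, Summable fun X : Finset (ZdEdge d) => (if e ∈ X then exp (t * dia X) * ∑ y ∈ X, lipV X y else 0))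
    (hL : ∀ e, ∑' X : Finset (ZdEdge d), (if e ∈ X then exp (t * dia X) * ∑ y ∈ X, lipV X y else 0) ≤ Ld)
    {F : LGConfig d (Matrix.specialUnitaryGroup (Fin N) ℂ) → ℝ} (hFm : Measurable F) {ΛF : Finset (ZdEdge d)} (hΛF : ΛF.Nonempty)
    (hFdep : DependsOn F (↑ΛF : Set (ZdEdge d))) {MF : ℝ} (hMF : ∀ σ, |F σ| ≤ MF) {δF : ZdEdge d → ℝ}
    (hδF : IsLipBound suFrobDist F δF) (n : ℕ) :
    ∀ s ∈ Set.Ioo (-s₀) s₀, iteratedDeriv n (fun s => ∫ σ, F σ ∂(ν s)) s =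
      (-1) ^ n * ∑' q : Fin n → Finset (ZdEdge d), trunc (ν s) F (fun X σ => V X σ - V X 1) q := by
  induction n with
  | zero =>
    intro s _
    rw [iteratedDeriv_zero, tsum_trunc_fin_zero_S, pow_zero, one_mul]
  | succ n ih =>
    intro s hs
    rw [iteratedDeriv_succ]
    have hev : iteratedDeriv n (fun s => ∫ σ, F σ ∂(ν s)) =ᶠ[𝓝 s]
        fun s => (-1) ^ n * ∑' q : Fin n → Finset (ZdEdge d), trunc (ν s) F (fun X σ => V X σ - V X 1) q :=
      Filter.eventually_of_mem (Ioo_mem_nhds hs.1 hs.2) fun s' hs' => ih s' hs'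
    rw [hev.deriv_eq]
    have h := (hasDerivAt_truncSum_of_response hd hCcov ht hprob hCov hVm hVdep hVb hlipV hC1 hSum hdia0 hdia hLd0 hLs hL hFm hΛF hFdep hMF hδF
      n s hs).const_mul ((-1 : ℝ) ^ n)
    rw [h.deriv, pow_succ]
    ring

/-- ★★★ **THE STATE IS `C^∞` ALONG EVERY DIRECTION OF FINITE EXPONENTIALLY DIAMETER-WEIGHTED LOAD, FOR EVERY MEMBER OF THE BALL.**  Member
`W ∈ Ball(a, Λ, t)`, direction `V ∈ Ball(a_V, Λ_V, t)` with Lipschitz witnesses of exponentially diameter-weighted load `≤ L_d`, room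
`a + s₀ a_V ≤ a'`, `Λ + s₀ Λ_V ≤ Λ'` inside the pair door at `(a', Λ', t)`, `t > 0`; ANY DLR selection `ν(s) ∈ 𝒢(W + sV)` on `|s| ≤ s₀`; `F` bounded
measurable local Frobenius-Lipschitz.  Then `s ↦ ∫ F dν(s)` is `ContDiffOn ℝ ∞` on `(−s₀, s₀)`.  `C^∞`, NOT analytic. -/
theorem contDiffOn_infty_integral_of_response (hd : 1 ≤ d) {s₀ Ccov t : ℝ} (hCcov : 0 ≤ Ccov) (ht : 0 < t)
    {ν : ℝ → Measure (LGConfig d (Matrix.specialUnitaryGroup (Fin N) ℂ))} (hprob : ∀ s ∈ Set.Icc (-s₀) s₀, IsProbabilityMeasure (ν s))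
    (hCov : ∀ s ∈ Set.Icc (-s₀) s₀,
      ∀ (f g : LGConfig d (Matrix.specialUnitaryGroup (Fin N) ℂ) → ℝ) (Δf Δg : Finset (ZdEdge d)) (Mf Mg : ℝ) (δf δg : ZdEdge d → ℝ),
      Measurable f → DependsOn f (↑Δf : Set (ZdEdge d)) → (∀ σ, |f σ| ≤ Mf) → IsLipBound suFrobDist f δf →
      Measurable g → DependsOn g (↑Δg : Set (ZdEdge d)) → (∀ σ, |g σ| ≤ Mg) → IsLipBound suFrobDist g δg →
        |cov[f, g; ν s]| ≤ Ccov * (∑ y ∈ Δg, δg y) * (∑ y ∈ Δf, δf y) * exp (-(t * setDistEdges Δf Δg)))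
    (hVm : ∀ X, Measurable (V X)) (hVdep : ∀ X, DependsOn (V X) (↑X : Set (ZdEdge d))) (hVb : ∀ X, ∃ C, ∀ U, |V X U| ≤ C)
    {lipV : Finset (ZdEdge d) → ZdEdge d → ℝ} (hlipV : ∀ X, IsLipBound suFrobDist (V X) (lipV X))
    (hC1 : ∀ (g : LGConfig d (Matrix.specialUnitaryGroup (Fin N) ℂ) → ℝ) (Δ : Finset (ZdEdge d)) (M : ℝ) (δ : ZdEdge d → ℝ),
      Measurable g → DependsOn g (↑Δ : Set (ZdEdge d)) → (∀ σ, |g σ| ≤ M) → IsLipBound suFrobDist g δ →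
      ∀ s ∈ Set.Ioo (-s₀) s₀, HasDerivAt (fun s => ∫ σ, g σ ∂(ν s)) (-(∑' X : Finset (ZdEdge d), cov[g, V X; ν s])) s)
    (hSum : ∀ s ∈ Set.Icc (-s₀) s₀, ∀ (g : LGConfig d (Matrix.specialUnitaryGroup (Fin N) ℂ) → ℝ) (Δ : Finset (ZdEdge d)) (M : ℝ)
      (δ : ZdEdge d → ℝ), Measurable g → DependsOn g (↑Δ : Set (ZdEdge d)) → (∀ σ, |g σ| ≤ M) → IsLipBound suFrobDist g δ →
      Summable fun X : Finset (ZdEdge d) => cov[g, V X; ν s])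
    {dia : Finset (ZdEdge d) → ℝ} (hdia0 : ∀ X, 0 ≤ dia X) (hdia : ∀ X, ∀ y ∈ X, ∀ z ∈ X, ‖y.1 - z.1‖ ≤ dia X) {Ld : ℝ} (hLd0 : 0 ≤ Ld)
    (hLs : ∀ e, Summable fun X : Finset (ZdEdge d) => (if e ∈ X then exp (t * dia X) * ∑ y ∈ X, lipV X y else 0))
    (hL : ∀ e, ∑' X : Finset (ZdEdge d), (if e ∈ X then exp (t * dia X) * ∑ y ∈ X, lipV X y else 0) ≤ Ld)
    {F : LGConfig d (Matrix.specialUnitaryGroup (Fin N) ℂ) → ℝ} (hFm : Measurable F) {ΛF : Finset (ZdEdge d)}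
    (hFdep : DependsOn F (↑ΛF : Set (ZdEdge d))) {MF : ℝ} (hMF : ∀ σ, |F σ| ≤ MF) {δF : ZdEdge d → ℝ}
    (hδF : IsLipBound suFrobDist F δF) :
    ContDiffOn ℝ ∞ (fun s => ∫ σ, F σ ∂(ν s)) (Set.Ioo (-s₀) s₀) := by
  classical
  -- a constant observable (empty support) is trivial
  by_cases hΛF : ΛF.Nonempty
  swap
  · have hconst : F = fun _ => F 1 := funext fun σ => hFdep (fun e he => by simp [Finset.not_nonempty_iff_eq_empty.1 hΛF] at he)
    have heq : ∀ s ∈ Set.Ioo (-s₀) s₀, (fun s => ∫ σ, F σ ∂(ν s)) s = (fun _ => F 1) s := fun s hs => by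
      haveI : IsProbabilityMeasure (ν s) := hprob s (Set.Ioo_subset_Icc_self hs)
      show ∫ σ, F σ ∂(ν s) = F 1
      rw [hconst]; simp
    exact contDiffOn_const.congr heq
  set R : ℕ → ℝ → ℝ := fun n s => (-1) ^ n * ∑' q : Fin n → Finset (ZdEdge d), trunc (ν s) F (fun X σ => V X σ - V X 1) q with hR
  have hderiv : ∀ n, ∀ s ∈ Set.Ioo (-s₀) s₀, HasDerivAt (R n) (R (n + 1) s) s := fun n s hs => by
    have h := (hasDerivAt_truncSum_of_response hd hCcov ht hprob hCov hVm hVdep hVb hlipV hC1 hSum hdia0 hdia hLd0 hLs hL hFm hΛF hFdep hMF hδF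
      n s hs).const_mul ((-1 : ℝ) ^ n)
    have e : (-1 : ℝ) ^ n * -(∑' q' : Fin (n + 1) → Finset (ZdEdge d), trunc (ν s) F (fun X σ => V X σ - V X 1) q') = R (n + 1) s := by
      simp only [hR, pow_succ]; ring
    rw [e] at h
    exact h
  have hall : ∀ K : ℕ, ∀ n, ContDiffOn ℝ K (R n) (Set.Ioo (-s₀) s₀) := by
    intro K
    induction K with
    | zero =>
      intro n
      exact contDiffOn_zero.2 fun s hs => (hderiv n s hs).continuousAt.continuousWithinAt
    | succ K ih =>
      intro n
      rw [show ((K + 1 : ℕ) : WithTop ℕ∞) = (K : WithTop ℕ∞) + 1 by push_cast; rfl,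
        contDiffOn_succ_iff_deriv_of_isOpen isOpen_Ioo]
      refine ⟨fun s hs => (hderiv n s hs).differentiableAt.differentiableWithinAt, fun h => absurd h (by simp), ?_⟩
      exact (ih (n + 1)).congr fun s hs => (hderiv n s hs).deriv
  have hR0 : ∀ s, R 0 s = ∫ σ, F σ ∂(ν s) := fun s => by
    simp only [hR, pow_zero, one_mul]; exact tsum_trunc_fin_zero_S (ν s) F _
  exact (contDiffOn_infty.2 fun K => hall K 0).congr fun s _ => (hR0 s).symm

end SUN

end Summit.Ventures.YMGap.RobustBall

end
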